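import Summits.NavierStokesRegularity.NavierStokesRegularity.Theorems.SoloSalvageDavlatov2020
import Literature.Analysis.FluidPDE.ContinuousInLpVersion
import HarnessLib

/-!
# Solo salvage for claim C76 `Davlatov2020`, part 2: Step 1 (Theorem 2) UNCONDITIONALLY

Continuation of `Theorems/SoloSalvageDavlatov2020.lean` (seat `ns-claims-salvage-p2`). Part 1 proved Step 1 of
`Literature/Claims/NS/Davlatov2020.lean` — the forced Leray–Hopf existence theorem (Thm 2 p.5 / §5) in the
typed class — for forces whose space–time lift is a.e.-strongly measurable (`step1_of_measurable`), the one
hypothesis the typed `ForceClass` (`f ∈ C([0,T];L²)`, divergence-free slices) does not record. This file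
removes it: by `ContinuousInLpOn.exists_stronglyMeasurable_version`
(`Literature/Analysis/FluidPDE/ContinuousInLpVersion.lean`; Robinson–Rodrigo–Sadowski 2016 §1.9.1 — an
`L²`-continuous family has a jointly measurable version with the same slices a.e.), the force is replaced by a
measurable version, Hopf's theorem (tree `hopf_existence_torus_holds`) is applied to the version, and the weak
formulation — which sees the force only through `∫⟪f(t), ψ(t)⟫` — is insensitive to the change
(`isWeakNSSolutionForcedOn_congr_force_ae`).

* `step1_holds : Step1_Theorem2` — Step 1 HOLDS as typed (classical: Leray 1934 / Hopf 1951 / Temam III.3.1).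
* `claim_of_steps_inputs₂` — the composition now needs exactly Steps 2, 3, 4, 5, 7, 8 + `UPrimeZeroInH`.

WHAT THIS IS NOT: not a claim about NS regularity or blow-up; not a claim about any author beyond the
typed locator.
-/

noncomputable section

open MeasureTheory Set Filter Function
open scoped ENNReal NNReal Topology RealInnerProductSpace

-- The mandated landing namespace repeats the summit name by design (D-0017).
set_option linter.dupNamespace false

namespace Summit.NavierStokesRegularity.NavierStokesRegularity.Theorems

namespace Davlatov2020

open Literature.Claims.NS.Davlatov2020 Literature.Analysis Literature.Analysis.FluidPDE
  Literature.Analysis.FunctionSpaces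

/-- The weak formulation sees the force only through its slices up to null sets: two forces whose slices
agree a.e. at every `t ∈ (0,T)` have the same forced weak solutions. [folklore] -/
private theorem isWeakNSSolutionForcedOn_congr_force_ae {T ν : ℝ}
    {f g : ℝ → UnitAddTorus (Fin 3) → EuclideanSpace ℝ (Fin 3)}
    {u₀ : UnitAddTorus (Fin 3) → EuclideanSpace ℝ (Fin 3)}
    {u : ℝ → UnitAddTorus (Fin 3) → EuclideanSpace ℝ (Fin 3)}
    (hfg : ∀ t ∈ Ioo 0 T, g t =ᵐ[volume] f t)
    (h : Torus.IsWeakNSSolutionForcedOn T ν g u₀ u) : Torus.IsWeakNSSolutionForcedOn T ν f u₀ u := by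
  refine ⟨h.1, h.2.1, h.2.2.1, fun ψ hψ hdiv => ?_⟩
  convert h.2.2.2 ψ hψ hdiv using 2
  refine setIntegral_congr_fun measurableSet_Ioo fun t ht => ?_
  refine integral_congr_ae ?_
  filter_upwards [hfg t ht] with x hx
  rw [hx]

/-- A version of an `L²`-continuous family with the same slices a.e. is again in `ForceClass T`. [folklore] -/
private theorem forceClass_congr {T : ℝ}
    {f g : ℝ → UnitAddTorus (Fin 3) → EuclideanSpace ℝ (Fin 3)} (hf : ForceClass T f)
    (hgf : ∀ t ∈ Icc 0 T, g t =ᵐ[volume] f t) : ForceClass T g := by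
  refine ⟨⟨fun t ht => (hf.1.1 t ht).ae_eq (hgf t ht).symm, fun t₀ ht₀ => ?_⟩, fun t ht θ hθ => ?_⟩
  · refine (hf.1.2 t₀ ht₀).congr' ?_
    filter_upwards [self_mem_nhdsWithin] with t ht
    exact eLpNorm_congr_ae (((hgf t ht).sub (hgf t₀ ht₀))).symm
  · have h0 := hf.2 t ht θ hθ
    rw [← h0]
    refine integral_congr_ae ?_
    filter_upwards [hgf t ht] with x hx
    rw [hx]

/-- **Step 1 (Theorem 2, p. 5 / §5 pp. 10–13) HOLDS as typed — CLASSICAL** (Leray 1934 §V; Hopf 1951; Temam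
1977 Ch. III Thm 3.1): for `T > 0`, `f ∈ C([0,T];L²)` with weakly divergence-free slices and `u₀ ∈ H`, problem
(4.4)–(4.7) on `𝕋³` has a weak solution in `L²(0,T;V) ∩ L^∞(0,T;H)`. Kernel route: measurable version `g` of
`f` (`ContinuousInLpOn.exists_stronglyMeasurable_version`), `step1_of_measurable` for `g`, and the a.e.
insensitivity of the weak identity to the force's slices. [cite: Davlatov2016NSPeriodic, Thm 2 p. 5; §5 pp. 10–13] -/
theorem step1_holds : Literature.Claims.NS.Davlatov2020.Step1_Theorem2 := by
  intro T hT f u₀ hf hu₀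
  obtain ⟨g, hgm, hgf⟩ :=
    hf.1.exists_stronglyMeasurable_version (X := UnitAddTorus (Fin 3)) one_le_two ENNReal.ofNat_ne_top
  have hgclass : ForceClass T g := forceClass_congr hf hgf
  have hgmeas : AEStronglyMeasurable (Torus.stLift g) (volume.restrict (Ioo 0 T ×ˢ univ)) :=
    Torus.aestronglyMeasurable_stLift_of_uncurry hgm.aestronglyMeasurable
  obtain ⟨u, hu⟩ := step1_of_measurable T hT g u₀ hgclass hgmeas hu₀
  exact ⟨u, isWeakNSSolutionForcedOn_congr_force_ae
    (fun t ht => hgf t (Ioo_subset_Icc_self ht)) hu.1, hu.2⟩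

/-- Bookkeeping: with Steps 1 and 6 and the inclusions discharged, the kernel composition `claim_of_steps`
needs exactly Steps 2, 3, 4, 5, 7, 8 and the printed sub-claim `UPrimeZeroInH` (l.734–748).
[cite: Davlatov2016NSPeriodic, Thms 3–4 p. 5; §6–§7 pp. 14–18] -/
theorem claim_of_steps_inputs₂ (h2 : Step2_Identity62) (h3 : Step3_TimeDerivL1) (h0 : UPrimeZeroInH)
    (h4 : Step4_C1H) (h5 : Step5_CV) (h7 : Step7_Uniqueness) (h8 : Step8_Section7) :
    Literature.Claims.NS.Davlatov2020.ClaimedTheorem :=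
  claim_of_steps_inputs step1_holds h2 h3 h0 h4 h5 h7 h8

end Davlatov2020

end Summit.NavierStokesRegularity.NavierStokesRegularity.Theorems
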